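import Mathlib.LinearAlgebra.FiniteDimensional.Basic
import Mathlib.LinearAlgebra.LinearIndependent.Defs
import Mathlib.Algebra.BigOperators.GroupWithZero.Action
import Mathlib.Data.Fintype.BigOperators
import Literature.Computability.AlgebraicComplexity.MatrixMultiplicationExponent
import HarnessLib

/-!
# Kauers–Moosbauer flip graphs: the two moves (flips and reductions) are sound

Topic `Literature/Computability/AlgebraicComplexity`, in the tree's coordinates for 3-tensors
(`t : ι → κ → μ → K`, rank-one tensors `triad w u v = w ⊗ u ⊗ v`, `tensorRank`,
`matMulTensor` of `MatrixMultiplicationExponent.lean`). Source: M. Kauers, J. Moosbauer,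
*Flip Graphs for Matrix Multiplication*, Proc. ISSAC 2023, 381–388 = arXiv:2212.01175 (KM),
§2–§3. Everything in this file is PROVED; there are no named facts.

KM work with *schemes*: finite SETS `S` of rank-one tensors whose sum is the matrix
multiplication tensor, `|S|` being the rank of the scheme (KM Def. 1). The tree (Bläser 2013) works
with INDEXED FAMILIES of triads `(w s ⊗ u s ⊗ v s)_{s ∈ σ}` summing to a tensor `t` (a bilinear
algorithm of length `|σ|`); `tensorRank t` is the least such length. The statements below are the
family versions of KM's statements: a flip replaces two members of the family and keeps the sum,
a reduction produces a family with one member fewer and the same sum. (KM's side condition in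
Def. 4 that the flipped set again has `|S|` elements is bookkeeping about sets and plays no role for
families.) All of them hold for an arbitrary tensor `t`, not only for `⟨n,m,p⟩`, and are stated so.

## Contents

* `triad_add_triad_eq_flip₁` … `triad_add_triad_eq_flip₃'` — the six FLIP IDENTITIES: for two
  rank-one tensors sharing one factor, KM §3 (display before Def. 4)
  `A⊗B⊗Γ + A⊗B'⊗Γ' = A⊗(B+B')⊗Γ + A⊗B'⊗(Γ'−Γ)` and its variant with
  `T = A⊗B⊗Γ'` (Def. 4 (3)), "analogously for any permutation of `A`, `B` and `Γ`" (Def. 4, last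
  sentence) — over every commutative ring.
* `sum_eq_sum_of_eq_off_pair` — bookkeeping: two families that agree outside `{i, j}` and have the
  same two-term sum at `{i, j}` have the same sum.
* `sum_triad_flip₁` — KM Def. 4, the case written out in the paper (shared first factor,
  `T = A⊗B'⊗Γ`), as an operation on an indexed family: if `w i = w j`, `i ≠ j`, then replacing
  `u i ↦ u i + u j` and `v j ↦ v j − v i` does not change `∑ s, w s ⊗ u s ⊗ v s`. Hence a flip of a
  decomposition of `t` is a decomposition of `t` of the same length (`KM`: "maps a correct scheme to
  another correct scheme"). The other five cases are the same three-line proof from the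
  corresponding identity.
* `sum_erase_triad_reduction_eq` — KM Prop. 3, THE CONSTRUCTION in its proof (case `A, B` of
  Def. 2), over a field: if for an index set `I` the first factors `w i`, `i ∈ I`, are non-zero and
  span a line (`dim ⟨A^{(i)}⟩_{i∈I} = 1`, Def. 2 (1)) and the second factors `u i`, `i ∈ I`, are
  linearly dependent (Def. 2 (2)), then for some `t₀ ∈ I` and scalars `c s` vanishing outside `I`,
  `∑_{s ≠ t₀} w s ⊗ u s ⊗ (v s + c s • v t₀) = ∑_s w s ⊗ u s ⊗ v s`
  (KM: `S' = {terms outside I} ∪ {A^{(i)}⊗B^{(i)}⊗(Γ^{(i)} + α_i β_i Γ^{(t)}) | i ∈ I∖{t}}`).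
* `tensorRank_le_card_sub_one_of_reducible`, `exists_sum_triad_fin_pred_of_reducible` — KM Prop. 3
  as printed for families: a reducible decomposition of length `|σ|` (resp. `r`) yields one of
  length `|σ| − 1` (resp. `r − 1`); `kauersMoosbauer2023_prop3` — the instance for `⟨k,m,n⟩`.
* `Reducible` — KM Def. 2 VERBATIM, all six role assignments "`A,B` or `B,A` or `A,Γ` or `Γ,A` or
  `B,Γ` or `Γ,B`" (grouped by the factor that spans a line), with `I` non-empty as printed;
  `reducible_of_caseAB` — the written-out case is an instance. `Reducible.exists_sum_erase_eq` —
  the reduction of Prop. 3 in EVERY case ("in the other cases the proof works analogously": the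
  case-`A,B` construction applied to the two named factors, transported back through the slot
  permutation); `Reducible.tensorRank_le_card_sub_one`, `Reducible.exists_sum_triad_fin_pred`,
  `kauersMoosbauer2023_prop3'` — Prop. 3 as printed from the hypothesis `Reducible` alone (plus
  Def. 1's "rank-one tensors are non-zero").
* `reducible_of_class_dep` (any field) and `reducible_iff_exists_class_dep_of_two` (two-element
  field): Def. 2 CLASS BY CLASS — reducible iff for some term `s₀` and slots `X ≠ Y` the `Y`-factors
  of the terms with `X`-factor equal to `X^{(s₀)}` are linearly dependent (over `ℤ₂` a line has one
  non-zero vector, so Def. 2 (1) confines `I` to such a class); the test search codes implement.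

## Faithfulness notes

* Def. 2 (2) "`{B^{(i)} | i ∈ I}` is linearly dependent" is read as dependence of the FAMILY
  `(u i)_{i ∈ I}` (`¬ LinearIndepOn K u I`), which is what the proof of Prop. 3 uses
  (`B^{(t)} = ∑_{i ≠ t} β_i B^{(i)}`) and what covers the basic case of two equal factors.
* Def. 2 (1) is `Module.finrank K (span K (w '' I)) = 1` verbatim; the rank-one tensors of a scheme
  are non-zero (Def. 1), whence the hypothesis `∀ i ∈ I, w i ≠ 0`, used exactly as in the printed
  proof ("`A^{(t)} = α_i A^{(i)}` for some `α_i`"). Non-emptiness of `I` (Def. 2) follows from (2).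
* §2 writes out the case `A, B` of Def. 2 / Prop. 3 with its explicit data (`I`, the line, the
  dependence); §3 states Def. 2 with all six cases as the predicate `Reducible w u v` and derives
  Prop. 3 from it, the five other cases being the case `A, B` for the slot-permuted family
  (`triad a b c x y z = a x * b y * c z` is symmetric in the three (slot, argument) pairs).
  In §3 the non-vanishing of the factors is taken in Def. 1's form `w s ⊗ u s ⊗ v s ≠ 0`.
* Not here: the flip GRAPH itself (Def. 8: vertices = orbits under the symmetry group), Thm. 7
  (over any field two rank-one tensors summing to two others form a flip — see
  `FlipCompleteness.lean`), Thm. 9 (weak connectivity), and all experimental counts of KM §4–5.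

## References

* M. Kauers, J. Moosbauer, *Flip Graphs for Matrix Multiplication*, ISSAC 2023, 381–388,
  doi:10.1145/3597066.3597120, arXiv:2212.01175: §2 Def. 1, Def. 2, Prop. 3; §3 Def. 4 and the
  displayed identity preceding it. [KauersMoosbauer2022FlipGraphs]
* M. Bläser, *Fast Matrix Multiplication*, Theory of Computing Library, Graduate Surveys 5 (2013),
  §4 (triads, rank). [Blaser2013]
-/

namespace Literature.Computability.AlgebraicComplexity

open scoped BigOperators
open Finset Module

namespace FlipGraph

/-! ## §1 Flips (KM §3, Def. 4): two rank-one tensors sharing a factor -/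

section Flip

variable {K : Type*} [CommRing K] {ι κ μ : Type*}

/-- **KM's flip identity** (§3, the display preceding Def. 4): for rank-one tensors sharing the
first factor, `A⊗B⊗Γ + A⊗B'⊗Γ' = A⊗(B+B')⊗Γ + A⊗B'⊗(Γ'−Γ)`; this is the flip of Def. 4 with
`T = A⊗B'⊗Γ` (`T₁ + T`, `T₂ − T`). Holds over every commutative ring.
[cite: KauersMoosbauer2022FlipGraphs, §3 (identity before Def. 4) and Def. 4] -/
theorem triad_add_triad_eq_flip₁ (a : ι → K) (b b' : κ → K) (c c' : μ → K) :
    triad a b c + triad a b' c' = triad a (b + b') c + triad a b' (c' - c) := by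
  funext x y z
  simp only [Pi.add_apply, Pi.sub_apply, triad_apply]
  ring

/-- KM Def. 4, shared first factor, the other choice `T = A⊗B⊗Γ'`:
`A⊗B⊗Γ + A⊗B'⊗Γ' = A⊗B⊗(Γ+Γ') + A⊗(B'−B)⊗Γ'`.
[cite: KauersMoosbauer2022FlipGraphs, Def. 4] -/
theorem triad_add_triad_eq_flip₁' (a : ι → K) (b b' : κ → K) (c c' : μ → K) :
    triad a b c + triad a b' c' = triad a b (c + c') + triad a (b' - b) c' := by
  funext x y z
  simp only [Pi.add_apply, Pi.sub_apply, triad_apply]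
  ring

/-- KM Def. 4 "analogously for any permutation of `A, B, Γ`": shared SECOND factor,
`T = A'⊗B⊗Γ`: `A⊗B⊗Γ + A'⊗B⊗Γ' = (A+A')⊗B⊗Γ + A'⊗B⊗(Γ'−Γ)`.
[cite: KauersMoosbauer2022FlipGraphs, Def. 4] -/
theorem triad_add_triad_eq_flip₂ (a a' : ι → K) (b : κ → K) (c c' : μ → K) :
    triad a b c + triad a' b c' = triad (a + a') b c + triad a' b (c' - c) := by
  funext x y z
  simp only [Pi.add_apply, Pi.sub_apply, triad_apply]
  ring

/-- KM Def. 4, shared second factor, `T = A⊗B⊗Γ'`: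
`A⊗B⊗Γ + A'⊗B⊗Γ' = A⊗B⊗(Γ+Γ') + (A'−A)⊗B⊗Γ'`.
[cite: KauersMoosbauer2022FlipGraphs, Def. 4] -/
theorem triad_add_triad_eq_flip₂' (a a' : ι → K) (b : κ → K) (c c' : μ → K) :
    triad a b c + triad a' b c' = triad a b (c + c') + triad (a' - a) b c' := by
  funext x y z
  simp only [Pi.add_apply, Pi.sub_apply, triad_apply]
  ring

/-- KM Def. 4, shared THIRD factor, `T = A'⊗B⊗Γ`:
`A⊗B⊗Γ + A'⊗B'⊗Γ = (A+A')⊗B⊗Γ + A'⊗(B'−B)⊗Γ`.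
[cite: KauersMoosbauer2022FlipGraphs, Def. 4] -/
theorem triad_add_triad_eq_flip₃ (a a' : ι → K) (b b' : κ → K) (c : μ → K) :
    triad a b c + triad a' b' c = triad (a + a') b c + triad a' (b' - b) c := by
  funext x y z
  simp only [Pi.add_apply, Pi.sub_apply, triad_apply]
  ring

/-- KM Def. 4, shared third factor, `T = A⊗B'⊗Γ`:
`A⊗B⊗Γ + A'⊗B'⊗Γ = A⊗(B+B')⊗Γ + (A'−A)⊗B'⊗Γ`.
[cite: KauersMoosbauer2022FlipGraphs, Def. 4] -/
theorem triad_add_triad_eq_flip₃' (a a' : ι → K) (b b' : κ → K) (c : μ → K) :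
    triad a b c + triad a' b' c = triad a (b + b') c + triad (a' - a) b' c := by
  funext x y z
  simp only [Pi.add_apply, Pi.sub_apply, triad_apply]
  ring

variable {σ : Type*} [Fintype σ]

/-- Bookkeeping behind "`(S ∖ {T₁, T₂}) ∪ {T₁ + T, T₂ − T}`" (KM Def. 4) for indexed families: if
two families agree outside two positions `i ≠ j` and their two-term sums at `i, j` agree, their sums
agree. [cite: KauersMoosbauer2022FlipGraphs, Def. 4] -/
theorem sum_eq_sum_of_eq_off_pair {N : Type*} [AddCommGroup N] {f g : σ → N} {i j : σ}
    (hij : i ≠ j) (hoff : ∀ s, s ≠ i → s ≠ j → g s = f s) (hpair : g i + g j = f i + f j) :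
    ∑ s, g s = ∑ s, f s := by
  rw [← sub_eq_zero, ← Finset.sum_sub_distrib,
    Fintype.sum_eq_add i j hij (fun s hs => by rw [hoff s hs.1 hs.2, sub_self])]
  -- `(g i - f i) + (g j - f j) = (g i + g j) - (f i + f j) = 0`
  rw [← sub_eq_zero.mpr hpair]
  abel

variable [DecidableEq σ]

/-- **KM Def. 4 as a move on indexed families** (the case written out in the paper: shared first
factor, `T = A⊗B'⊗Γ`; the move the flip-graph search engines implement): if `w i = w j` for two
positions `i ≠ j`, then replacing `u i` by `u i + u j` and `v j` by `v j − v i` leaves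
`∑ s, w s ⊗ u s ⊗ v s` unchanged. In particular a flip of a decomposition of a tensor `t` (e.g. of a
matrix multiplication scheme) is again a decomposition of `t`, of the same length.
[cite: KauersMoosbauer2022FlipGraphs, Def. 4] -/
theorem sum_triad_flip₁ (w : σ → ι → K) (u : σ → κ → K) (v : σ → μ → K) {i j : σ}
    (hij : i ≠ j) (hA : w j = w i) :
    ∑ s, triad (w s) (Function.update u i (u i + u j) s) (Function.update v j (v j - v i) s) =
      ∑ s, triad (w s) (u s) (v s) := by
  refine sum_eq_sum_of_eq_off_pair hij (fun s hsi hsj => ?_) ?_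
  · rw [Function.update_of_ne hsi, Function.update_of_ne hsj]
  · rw [Function.update_self, Function.update_of_ne hij, Function.update_of_ne hij.symm,
      Function.update_self, hA]
    exact (triad_add_triad_eq_flip₁ (w i) (u i) (u j) (v i) (v j)).symm

/-- The flipped family is a decomposition of the same tensor, hence witnesses the same rank bound:
if `t = ∑ s, w s ⊗ u s ⊗ v s` then `t` is also the sum of the flipped family, so
`tensorRank t ≤ |σ|` is witnessed by either. [cite: KauersMoosbauer2022FlipGraphs, Def. 4] -/
theorem eq_sum_triad_flip₁ {t : ι → κ → μ → K} (w : σ → ι → K) (u : σ → κ → K)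
    (v : σ → μ → K) (ht : t = ∑ s, triad (w s) (u s) (v s)) {i j : σ} (hij : i ≠ j)
    (hA : w j = w i) :
    t = ∑ s, triad (w s) (Function.update u i (u i + u j) s)
      (Function.update v j (v j - v i) s) :=
  ht.trans (sum_triad_flip₁ w u v hij hA).symm

end Flip

/-! ## §2 Reductions (KM §2, Def. 2 and Prop. 3), case `A, B` -/

section Reduction

variable {K : Type*} [Field K] {ι κ μ : Type*}

/-- `triad` is additive in the second slot (bookkeeping). [folklore] -/
private theorem triad_add_snd (a : ι → K) (b b' : κ → K) (c : μ → K) :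
    triad a (b + b') c = triad a b c + triad a b' c := by
  funext x y z; simp only [Pi.add_apply, triad_apply]; ring

/-- `triad` is additive in the third slot (bookkeeping). [folklore] -/
private theorem triad_add_thd (a : ι → K) (b : κ → K) (c c' : μ → K) :
    triad a b (c + c') = triad a b c + triad a b c' := by
  funext x y z; simp only [Pi.add_apply, triad_apply]; ring

/-- `triad` vanishes when the second slot does (bookkeeping). [folklore] -/
private theorem triad_zero_snd (a : ι → K) (c : μ → K) : triad a (0 : κ → K) c = 0 := by
  funext x y z; simp

/-- `triad` vanishes when the third slot does (bookkeeping). [folklore] -/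
private theorem triad_zero_thd (a : ι → K) (b : κ → K) : triad a b (0 : μ → K) = 0 := by
  funext x y z; simp

/-- `triad` commutes with finite sums in the second slot (bookkeeping). [folklore] -/
private theorem triad_sum_snd {τ : Type*} (a : ι → K) (S : Finset τ) (f : τ → κ → K)
    (c : μ → K) : triad a (∑ s ∈ S, f s) c = ∑ s ∈ S, triad a (f s) c := by
  classical
  induction S using Finset.induction_on with
  | empty => simp [triad_zero_snd]
  | insert x S hx ih => rw [Finset.sum_insert hx, Finset.sum_insert hx, triad_add_snd, ih]

/-- Moving scalars between the slots of a triad: `(α•a) ⊗ (β•b) ⊗ c = a ⊗ b ⊗ ((α β)•c)`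
(bookkeeping). [folklore] -/
private theorem triad_smul_smul_eq (α β : K) (a : ι → K) (b : κ → K) (c : μ → K) :
    triad (α • a) (β • b) c = triad a b ((α * β) • c) := by
  funext x y z; simp only [triad_apply, Pi.smul_apply, smul_eq_mul]; ring

variable {σ : Type*} [Fintype σ] [DecidableEq σ]

/-- **KM Prop. 3 — the reduction, as constructed in its proof (case `A, B` of Def. 2).**
Let `(w s ⊗ u s ⊗ v s)_{s ∈ σ}` be a family of rank-one tensors and `I` a set of indices such that
(Def. 2 (1)) the first factors `w i`, `i ∈ I`, span a line, `dim_K ⟨w i⟩_{i ∈ I} = 1`, each being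
non-zero (rank-one tensors are non-zero, Def. 1), and (Def. 2 (2)) the second factors `u i`, `i ∈ I`,
are linearly dependent. Then (proof of Prop. 3) there are `t₀ ∈ I` — an index with
`u t₀ = ∑_{i ∈ I∖{t₀}} β_i • u i` and `w t₀ = α_i • w i` — and scalars `c i = α_i β_i` on `I`
(`c = 0` outside `I`) such that dropping the term `t₀` and replacing `v i` by `v i + c i • v t₀`
keeps the sum: `∑_{s ≠ t₀} w s ⊗ u s ⊗ (v s + c s • v t₀) = ∑_s w s ⊗ u s ⊗ v s`. This is KM's
`S' = {A^{(i)}⊗B^{(i)}⊗Γ^{(i)} | i ∉ I} ∪ {A^{(i)}⊗B^{(i)}⊗(Γ^{(i)} + α_iβ_iΓ^{(t)}) | i ∈ I∖{t}}`.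
[cite: KauersMoosbauer2022FlipGraphs, Def. 2 and Prop. 3 (proof)] -/
theorem sum_erase_triad_reduction_eq (w : σ → ι → K) (u : σ → κ → K) (v : σ → μ → K)
    (I : Finset σ) (hw : ∀ i ∈ I, w i ≠ 0)
    (h1 : Module.finrank K (Submodule.span K (w '' (I : Set σ))) = 1)
    (h2 : ¬ LinearIndepOn K u (I : Set σ)) :
    ∃ t₀ ∈ I, ∃ c : σ → K, (∀ s ∉ I, c s = 0) ∧
      ∑ s ∈ univ.erase t₀, triad (w s) (u s) (v s + c s • v t₀) =
        ∑ s, triad (w s) (u s) (v s) := by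
  -- Def. 2 (2): a non-trivial vanishing combination `∑_{i ∈ I} g i • u i = 0`, `g t₀ ≠ 0`.
  rw [linearIndepOn_finset_iff] at h2
  push Not at h2
  obtain ⟨g, hg0, t₀, ht₀, hgt⟩ := h2
  -- hence `u t₀ = ∑_{i ∈ I ∖ {t₀}} β i • u i` with `β i = -(g i / g t₀)`.
  set β : σ → K := fun s => -(g s * (g t₀)⁻¹) with hβ
  have hsplit : g t₀ • u t₀ + ∑ s ∈ I.erase t₀, g s • u s = 0 := by
    rwa [Finset.add_sum_erase I (fun s => g s • u s) ht₀]
  have hut : u t₀ = ∑ s ∈ I.erase t₀, β s • u s := by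
    have h' : u t₀ = -((g t₀)⁻¹ • ∑ s ∈ I.erase t₀, g s • u s) := by
      rw [eq_neg_iff_add_eq_zero, ← inv_smul_smul₀ hgt (u t₀), ← smul_add, hsplit, smul_zero]
    rw [h', Finset.smul_sum, ← Finset.sum_neg_distrib]
    refine Finset.sum_congr rfl fun s _ => ?_
    rw [hβ, smul_smul, neg_smul, mul_comm]
  -- Def. 2 (1): every `w i`, `i ∈ I`, spans the line, so `w t₀ = α i • w i`.
  have hline : ∀ s ∈ I, ∃ a : K, a • w s = w t₀ := by
    intro s hs
    have hsV : w s ∈ Submodule.span K (w '' (I : Set σ)) :=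
      Submodule.subset_span (Set.mem_image_of_mem w (Finset.mem_coe.mpr hs))
    have htV : w t₀ ∈ Submodule.span K (w '' (I : Set σ)) :=
      Submodule.subset_span (Set.mem_image_of_mem w (Finset.mem_coe.mpr ht₀))
    have hne : (⟨w s, hsV⟩ : Submodule.span K (w '' (I : Set σ))) ≠ 0 := by
      intro h0
      exact hw s hs (by simpa using congrArg Subtype.val h0)
    obtain ⟨a, ha⟩ := (finrank_eq_one_iff_of_nonzero' _ hne).mp h1 ⟨w t₀, htV⟩
    exact ⟨a, by simpa using congrArg Subtype.val ha⟩
  choose! α hα using hline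
  -- KM's new third factors: `Γ^{(i)} + α_i β_i Γ^{(t₀)}` on `I ∖ {t₀}`, unchanged outside `I`.
  refine ⟨t₀, ht₀, fun s => if s ∈ I then α s * β s else 0, fun s hs => if_neg hs, ?_⟩
  -- the dropped term, redistributed over `I ∖ {t₀}`:
  have hkey : triad (w t₀) (u t₀) (v t₀) =
      ∑ s ∈ I.erase t₀, triad (w s) (u s) ((α s * β s) • v t₀) := by
    rw [hut, triad_sum_snd]
    refine Finset.sum_congr rfl fun s hs => ?_
    rw [← hα s (Finset.mem_of_mem_erase hs), triad_smul_smul_eq]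
  -- assemble: `∑_{s ≠ t₀} (term s + correction s) = ∑_{s ≠ t₀} term s + term t₀ = ∑_s term s`.
  have hcorr : ∑ s ∈ univ.erase t₀, triad (w s) (u s) ((if s ∈ I then α s * β s else 0) • v t₀) =
      triad (w t₀) (u t₀) (v t₀) := by
    have hzero : ∀ s ∈ univ.erase t₀, s ∉ I.erase t₀ →
        triad (w s) (u s) ((if s ∈ I then α s * β s else 0) • v t₀) = 0 := by
      intro s hs hsI
      have hsI' : s ∉ I := fun h => hsI (Finset.mem_erase.mpr ⟨(Finset.mem_erase.mp hs).1, h⟩)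
      rw [if_neg hsI', zero_smul, triad_zero_thd]
    rw [← Finset.sum_subset (Finset.erase_subset_erase t₀ (Finset.subset_univ I)) hzero, hkey]
    refine Finset.sum_congr rfl fun s hs => ?_
    rw [if_pos (Finset.mem_of_mem_erase hs)]
  calc ∑ s ∈ univ.erase t₀, triad (w s) (u s) (v s + (if s ∈ I then α s * β s else 0) • v t₀)
      = ∑ s ∈ univ.erase t₀, triad (w s) (u s) (v s) +
          ∑ s ∈ univ.erase t₀, triad (w s) (u s) ((if s ∈ I then α s * β s else 0) • v t₀) := by
        rw [← Finset.sum_add_distrib]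
        exact Finset.sum_congr rfl fun s _ => triad_add_thd _ _ _ _
    _ = ∑ s ∈ univ.erase t₀, triad (w s) (u s) (v s) + triad (w t₀) (u t₀) (v t₀) := by
        rw [hcorr]
    _ = ∑ s, triad (w s) (u s) (v s) :=
        Finset.sum_erase_add _ (fun s => triad (w s) (u s) (v s)) (Finset.mem_univ t₀)

/-- **KM Prop. 3 (rank drop), family form over an arbitrary tensor.** If
`t = ∑_{s ∈ σ} w s ⊗ u s ⊗ v s` is reducible in the sense of Def. 2 (case `A, B`: on some index set
`I` the non-zero first factors span a line and the second factors are linearly dependent), then `t`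
has a decomposition into `|σ| − 1` triads; in particular `R(t) ≤ |σ| − 1`.
[cite: KauersMoosbauer2022FlipGraphs, Prop. 3] -/
theorem tensorRank_le_card_sub_one_of_reducible {t : ι → κ → μ → K} (w : σ → ι → K)
    (u : σ → κ → K) (v : σ → μ → K) (ht : t = ∑ s, triad (w s) (u s) (v s)) (I : Finset σ)
    (hw : ∀ i ∈ I, w i ≠ 0) (h1 : Module.finrank K (Submodule.span K (w '' (I : Set σ))) = 1)
    (h2 : ¬ LinearIndepOn K u (I : Set σ)) :
    tensorRank t ≤ Fintype.card σ - 1 := by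
  obtain ⟨t₀, -, c, -, hsum⟩ := sum_erase_triad_reduction_eq w u v I hw h1 h2
  have hcard : Fintype.card (univ.erase t₀ : Finset σ) = Fintype.card σ - 1 := by
    rw [Fintype.card_coe, Finset.card_erase_of_mem (Finset.mem_univ t₀), Finset.card_univ]
  rw [← hcard]
  refine tensorRank_le_card_of_eq_sum (fun s : (univ.erase t₀ : Finset σ) => w s)
    (fun s => u s) (fun s => v s + c s • v t₀) ?_
  rw [ht, ← hsum, ← Finset.sum_coe_sort]

/-- **KM Prop. 3 as printed, for families indexed by `Fin r`:** a reducible decomposition of a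
tensor `t` into `r` rank-one tensors (Def. 2, case `A, B`) yields a decomposition of `t` into
`r − 1` rank-one tensors ("Let `S` be a reducible … scheme of rank `r`. Then there exists a … scheme
of rank `r − 1`"; KM call the new scheme a *reduction* of `S`).
[cite: KauersMoosbauer2022FlipGraphs, Prop. 3] -/
theorem exists_sum_triad_fin_pred_of_reducible {t : ι → κ → μ → K} {r : ℕ} (w : Fin r → ι → K)
    (u : Fin r → κ → K) (v : Fin r → μ → K) (ht : t = ∑ s, triad (w s) (u s) (v s))
    (I : Finset (Fin r)) (hw : ∀ i ∈ I, w i ≠ 0)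
    (h1 : Module.finrank K (Submodule.span K (w '' (I : Set (Fin r)))) = 1)
    (h2 : ¬ LinearIndepOn K u (I : Set (Fin r))) :
    ∃ (w' : Fin (r - 1) → ι → K) (u' : Fin (r - 1) → κ → K) (v' : Fin (r - 1) → μ → K),
      t = ∑ s, triad (w' s) (u' s) (v' s) := by
  obtain ⟨t₀, -, c, -, hsum⟩ := sum_erase_triad_reduction_eq w u v I hw h1 h2
  have hcard : Fintype.card (univ.erase t₀ : Finset (Fin r)) = r - 1 := by
    rw [Fintype.card_coe, Finset.card_erase_of_mem (Finset.mem_univ t₀), Finset.card_univ,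
      Fintype.card_fin]
  let e : (univ.erase t₀ : Finset (Fin r)) ≃ Fin (r - 1) := Fintype.equivFinOfCardEq hcard
  refine ⟨fun i => w (e.symm i), fun i => u (e.symm i), fun i => v (e.symm i) + c (e.symm i) • v t₀,
    ?_⟩
  rw [ht, ← hsum, ← Finset.sum_coe_sort]
  exact (e.symm.sum_comp (fun s : (univ.erase t₀ : Finset (Fin r)) =>
    triad (w s) (u s) (v s + c s • v t₀))).symm

/-- **KM Prop. 3 for matrix multiplication schemes** (the statement printed, case `A, B` of
Def. 2, in the tree's coordinates `matMulTensor K k m n = ⟨k,m,n⟩`): a reducible `⟨k,m,n⟩`-scheme with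
`r` rank-one tensors yields a `⟨k,m,n⟩`-scheme with `r − 1` rank-one tensors, so
`R(⟨k,m,n⟩) ≤ r − 1`. [cite: KauersMoosbauer2022FlipGraphs, Prop. 3] -/
theorem kauersMoosbauer2023_prop3 {k m n r : ℕ} (w : Fin r → Fin k × Fin n → K)
    (u : Fin r → Fin k × Fin m → K) (v : Fin r → Fin m × Fin n → K)
    (hS : matMulTensor K k m n = ∑ s, triad (w s) (u s) (v s)) (I : Finset (Fin r))
    (hw : ∀ i ∈ I, w i ≠ 0)
    (h1 : Module.finrank K (Submodule.span K (w '' (I : Set (Fin r)))) = 1)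
    (h2 : ¬ LinearIndepOn K u (I : Set (Fin r))) :
    (∃ (w' : Fin (r - 1) → Fin k × Fin n → K) (u' : Fin (r - 1) → Fin k × Fin m → K)
        (v' : Fin (r - 1) → Fin m × Fin n → K),
        matMulTensor K k m n = ∑ s, triad (w' s) (u' s) (v' s)) ∧
      tensorRank (matMulTensor K k m n) ≤ r - 1 := by
  refine ⟨exists_sum_triad_fin_pred_of_reducible w u v hS I hw h1 h2, ?_⟩
  simpa using tensorRank_le_card_sub_one_of_reducible w u v hS I hw h1 h2

end Reduction

/-! ## §3 KM Def. 2 verbatim (all six role assignments) and Prop. 3 in general -/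

section ReducibleDef

variable {K : Type*} [Field K] {ι κ μ : Type*} {σ : Type*}

/-- **KM Def. 2 (reducible), all six cases, for an indexed family** `(w s ⊗ u s ⊗ v s)_{s ∈ σ}`
of rank-one tensors (KM: "`S = {A^{(i)} ⊗ B^{(i)} ⊗ Γ^{(i)} | i ∈ {1,…,r}}` … We call `S`
*reducible* if there is a nonempty set `I ⊆ {1,…,r}` such that (1) `dim_K ⟨A^{(i)}⟩_{i∈I} = 1` and
(2) `{B^{(i)} | i ∈ I}` is linearly dependent over `K`, or analogously with `B,A` or `A,Γ` or
`Γ,A` or `B,Γ` or `Γ,B` in place of `A,B`"). The six ordered pairs `(X, Y)` of distinct factors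
are grouped by the factor `X` that spans a line; (2) is read as dependence of the family
`(Y^{(i)})_{i ∈ I}` (faithfulness notes in the module docstring).
[cite: KauersMoosbauer2022FlipGraphs, Def. 2] -/
def Reducible (w : σ → ι → K) (u : σ → κ → K) (v : σ → μ → K) : Prop :=
  ∃ I : Finset σ, I.Nonempty ∧
    ((finrank K (Submodule.span K (w '' (I : Set σ))) = 1 ∧
        (¬ LinearIndepOn K u (I : Set σ) ∨ ¬ LinearIndepOn K v (I : Set σ))) ∨
      (finrank K (Submodule.span K (u '' (I : Set σ))) = 1 ∧
        (¬ LinearIndepOn K w (I : Set σ) ∨ ¬ LinearIndepOn K v (I : Set σ))) ∨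
      (finrank K (Submodule.span K (v '' (I : Set σ))) = 1 ∧
        (¬ LinearIndepOn K w (I : Set σ) ∨ ¬ LinearIndepOn K u (I : Set σ))))

/-- The case `A, B` of Def. 2 written out in the paper (`dim ⟨A^{(i)}⟩_{i∈I} = 1`,
`{B^{(i)}}_{i∈I}` dependent) is a case of `Reducible`; non-emptiness of `I` is automatic, the empty
family being independent. [cite: KauersMoosbauer2022FlipGraphs, Def. 2] -/
theorem reducible_of_caseAB {w : σ → ι → K} {u : σ → κ → K} (v : σ → μ → K) (I : Finset σ)
    (h1 : finrank K (Submodule.span K (w '' (I : Set σ))) = 1)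
    (h2 : ¬ LinearIndepOn K u (I : Set σ)) : Reducible w u v := by
  refine ⟨I, ?_, Or.inl ⟨h1, Or.inl h2⟩⟩
  rw [Finset.nonempty_iff_ne_empty]
  rintro rfl
  exact h2 (by rw [Finset.coe_empty]; exact linearIndepOn_empty K u)

/-- A rank-one tensor `a ⊗ b ⊗ c` is non-zero only if each factor is (KM Def. 1: "rank-one tensors
are non-zero tensors that can be written as `A ⊗ B ⊗ Γ`"). [folklore] -/
private theorem ne_zero_of_triad_ne_zero {a : ι → K} {b : κ → K} {c : μ → K}
    (h : triad a b c ≠ 0) : a ≠ 0 ∧ b ≠ 0 ∧ c ≠ 0 := by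
  refine ⟨?_, ?_, ?_⟩ <;> rintro rfl <;> apply h <;> funext x y z <;>
    simp only [triad_apply, Pi.zero_apply, zero_mul, mul_zero]

/-- Slot transport (bookkeeping): an identity of sums of triads read with the slots in the order
`(1,3,2)` yields the identity in the order `(1,2,3)`. [folklore] -/
private theorem sum_triad_transport₁₃₂ {A B : Finset σ} {w₁ w₂ : σ → ι → K} {u₁ u₂ : σ → κ → K}
    {v₁ v₂ : σ → μ → K}
    (H : ∑ s ∈ A, triad (w₁ s) (v₁ s) (u₁ s) = ∑ s ∈ B, triad (w₂ s) (v₂ s) (u₂ s)) :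
    ∑ s ∈ A, triad (w₁ s) (u₁ s) (v₁ s) = ∑ s ∈ B, triad (w₂ s) (u₂ s) (v₂ s) := by
  funext x y z
  have h := congrFun (congrFun (congrFun H x) z) y
  simp only [Finset.sum_apply, triad_apply] at h ⊢
  calc ∑ s ∈ A, w₁ s x * u₁ s y * v₁ s z = ∑ s ∈ A, w₁ s x * v₁ s z * u₁ s y :=
        Finset.sum_congr rfl fun s _ => by ring
    _ = ∑ s ∈ B, w₂ s x * v₂ s z * u₂ s y := h
    _ = ∑ s ∈ B, w₂ s x * u₂ s y * v₂ s z := Finset.sum_congr rfl fun s _ => by ring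

/-- Slot transport, order `(2,1,3)`. [folklore] -/
private theorem sum_triad_transport₂₁₃ {A B : Finset σ} {w₁ w₂ : σ → ι → K} {u₁ u₂ : σ → κ → K}
    {v₁ v₂ : σ → μ → K}
    (H : ∑ s ∈ A, triad (u₁ s) (w₁ s) (v₁ s) = ∑ s ∈ B, triad (u₂ s) (w₂ s) (v₂ s)) :
    ∑ s ∈ A, triad (w₁ s) (u₁ s) (v₁ s) = ∑ s ∈ B, triad (w₂ s) (u₂ s) (v₂ s) := by
  funext x y z
  have h := congrFun (congrFun (congrFun H y) x) z
  simp only [Finset.sum_apply, triad_apply] at h ⊢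
  calc ∑ s ∈ A, w₁ s x * u₁ s y * v₁ s z = ∑ s ∈ A, u₁ s y * w₁ s x * v₁ s z :=
        Finset.sum_congr rfl fun s _ => by ring
    _ = ∑ s ∈ B, u₂ s y * w₂ s x * v₂ s z := h
    _ = ∑ s ∈ B, w₂ s x * u₂ s y * v₂ s z := Finset.sum_congr rfl fun s _ => by ring

/-- Slot transport, order `(2,3,1)`. [folklore] -/
private theorem sum_triad_transport₂₃₁ {A B : Finset σ} {w₁ w₂ : σ → ι → K} {u₁ u₂ : σ → κ → K}
    {v₁ v₂ : σ → μ → K}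
    (H : ∑ s ∈ A, triad (u₁ s) (v₁ s) (w₁ s) = ∑ s ∈ B, triad (u₂ s) (v₂ s) (w₂ s)) :
    ∑ s ∈ A, triad (w₁ s) (u₁ s) (v₁ s) = ∑ s ∈ B, triad (w₂ s) (u₂ s) (v₂ s) := by
  funext x y z
  have h := congrFun (congrFun (congrFun H y) z) x
  simp only [Finset.sum_apply, triad_apply] at h ⊢
  calc ∑ s ∈ A, w₁ s x * u₁ s y * v₁ s z = ∑ s ∈ A, u₁ s y * v₁ s z * w₁ s x :=
        Finset.sum_congr rfl fun s _ => by ring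
    _ = ∑ s ∈ B, u₂ s y * v₂ s z * w₂ s x := h
    _ = ∑ s ∈ B, w₂ s x * u₂ s y * v₂ s z := Finset.sum_congr rfl fun s _ => by ring

/-- Slot transport, order `(3,1,2)`. [folklore] -/
private theorem sum_triad_transport₃₁₂ {A B : Finset σ} {w₁ w₂ : σ → ι → K} {u₁ u₂ : σ → κ → K}
    {v₁ v₂ : σ → μ → K}
    (H : ∑ s ∈ A, triad (v₁ s) (w₁ s) (u₁ s) = ∑ s ∈ B, triad (v₂ s) (w₂ s) (u₂ s)) :
    ∑ s ∈ A, triad (w₁ s) (u₁ s) (v₁ s) = ∑ s ∈ B, triad (w₂ s) (u₂ s) (v₂ s) := by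
  funext x y z
  have h := congrFun (congrFun (congrFun H z) x) y
  simp only [Finset.sum_apply, triad_apply] at h ⊢
  calc ∑ s ∈ A, w₁ s x * u₁ s y * v₁ s z = ∑ s ∈ A, v₁ s z * w₁ s x * u₁ s y :=
        Finset.sum_congr rfl fun s _ => by ring
    _ = ∑ s ∈ B, v₂ s z * w₂ s x * u₂ s y := h
    _ = ∑ s ∈ B, w₂ s x * u₂ s y * v₂ s z := Finset.sum_congr rfl fun s _ => by ring

/-- Slot transport, order `(3,2,1)`. [folklore] -/
private theorem sum_triad_transport₃₂₁ {A B : Finset σ} {w₁ w₂ : σ → ι → K} {u₁ u₂ : σ → κ → K}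
    {v₁ v₂ : σ → μ → K}
    (H : ∑ s ∈ A, triad (v₁ s) (u₁ s) (w₁ s) = ∑ s ∈ B, triad (v₂ s) (u₂ s) (w₂ s)) :
    ∑ s ∈ A, triad (w₁ s) (u₁ s) (v₁ s) = ∑ s ∈ B, triad (w₂ s) (u₂ s) (v₂ s) := by
  funext x y z
  have h := congrFun (congrFun (congrFun H z) y) x
  simp only [Finset.sum_apply, triad_apply] at h ⊢
  calc ∑ s ∈ A, w₁ s x * u₁ s y * v₁ s z = ∑ s ∈ A, v₁ s z * u₁ s y * w₁ s x :=
        Finset.sum_congr rfl fun s _ => by ring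
    _ = ∑ s ∈ B, v₂ s z * u₂ s y * w₂ s x := h
    _ = ∑ s ∈ B, w₂ s x * u₂ s y * v₂ s z := Finset.sum_congr rfl fun s _ => by ring

variable [Fintype σ] [DecidableEq σ]

/-- **KM Prop. 3, the reduction in every case of Def. 2** ("We prove the statement in the case that
the conditions in Def. 2 hold for `A` and `B`. In the other cases the proof works analogously"):
a reducible family of (non-zero, Def. 1) rank-one tensors `(w s ⊗ u s ⊗ v s)_{s ∈ σ}` can be
replaced by a family indexed by `σ ∖ {t₀}` with the same sum — in each case the construction of
`sum_erase_triad_reduction_eq` applied with the two factors named in Def. 2 in the roles of `A, B`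
and the remaining factor modified (`Z^{(i)} ↦ Z^{(i)} + α_i β_i Z^{(t)}`).
[cite: KauersMoosbauer2022FlipGraphs, Prop. 3 (proof)] -/
theorem Reducible.exists_sum_erase_eq {w : σ → ι → K} {u : σ → κ → K} {v : σ → μ → K}
    (hred : Reducible w u v) (h0 : ∀ s, triad (w s) (u s) (v s) ≠ 0) :
    ∃ (t₀ : σ) (w' : σ → ι → K) (u' : σ → κ → K) (v' : σ → μ → K),
      ∑ s ∈ univ.erase t₀, triad (w' s) (u' s) (v' s) = ∑ s, triad (w s) (u s) (v s) := by
  have hw : ∀ s, w s ≠ 0 := fun s => (ne_zero_of_triad_ne_zero (h0 s)).1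
  have hu : ∀ s, u s ≠ 0 := fun s => (ne_zero_of_triad_ne_zero (h0 s)).2.1
  have hv : ∀ s, v s ≠ 0 := fun s => (ne_zero_of_triad_ne_zero (h0 s)).2.2
  obtain ⟨I, -, hI⟩ := hred
  rcases hI with ⟨h1, h2 | h2⟩ | ⟨h1, h2 | h2⟩ | ⟨h1, h2 | h2⟩
  · -- `A, B`: modify `Γ`
    obtain ⟨t₀, -, c, -, h⟩ := sum_erase_triad_reduction_eq w u v I (fun i _ => hw i) h1 h2
    exact ⟨t₀, w, u, fun s => v s + c s • v t₀, h⟩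
  · -- `A, Γ`: modify `B`
    obtain ⟨t₀, -, c, -, h⟩ := sum_erase_triad_reduction_eq w v u I (fun i _ => hw i) h1 h2
    exact ⟨t₀, w, fun s => u s + c s • u t₀, v, sum_triad_transport₁₃₂ h⟩
  · -- `B, A`: modify `Γ`
    obtain ⟨t₀, -, c, -, h⟩ := sum_erase_triad_reduction_eq u w v I (fun i _ => hu i) h1 h2
    exact ⟨t₀, w, u, fun s => v s + c s • v t₀, sum_triad_transport₂₁₃ h⟩
  · -- `B, Γ`: modify `A`
    obtain ⟨t₀, -, c, -, h⟩ := sum_erase_triad_reduction_eq u v w I (fun i _ => hu i) h1 h2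
    exact ⟨t₀, fun s => w s + c s • w t₀, u, v, sum_triad_transport₂₃₁ h⟩
  · -- `Γ, A`: modify `B`
    obtain ⟨t₀, -, c, -, h⟩ := sum_erase_triad_reduction_eq v w u I (fun i _ => hv i) h1 h2
    exact ⟨t₀, w, fun s => u s + c s • u t₀, v, sum_triad_transport₃₁₂ h⟩
  · -- `Γ, B`: modify `A`
    obtain ⟨t₀, -, c, -, h⟩ := sum_erase_triad_reduction_eq v u w I (fun i _ => hv i) h1 h2
    exact ⟨t₀, fun s => w s + c s • w t₀, u, v, sum_triad_transport₃₂₁ h⟩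

/-- **KM Prop. 3 (rank drop) in general, family form over an arbitrary tensor:** a reducible
decomposition `t = ∑_{s ∈ σ} w s ⊗ u s ⊗ v s` into non-zero rank-one tensors yields one of length
`|σ| − 1`, so `R(t) ≤ |σ| − 1`. [cite: KauersMoosbauer2022FlipGraphs, Prop. 3] -/
theorem Reducible.tensorRank_le_card_sub_one {t : ι → κ → μ → K} {w : σ → ι → K}
    {u : σ → κ → K} {v : σ → μ → K} (hred : Reducible w u v)
    (h0 : ∀ s, triad (w s) (u s) (v s) ≠ 0) (ht : t = ∑ s, triad (w s) (u s) (v s)) :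
    tensorRank t ≤ Fintype.card σ - 1 := by
  obtain ⟨t₀, w', u', v', hsum⟩ := hred.exists_sum_erase_eq h0
  have hcard : Fintype.card (univ.erase t₀ : Finset σ) = Fintype.card σ - 1 := by
    rw [Fintype.card_coe, Finset.card_erase_of_mem (Finset.mem_univ t₀), Finset.card_univ]
  rw [← hcard]
  refine tensorRank_le_card_of_eq_sum (fun s : (univ.erase t₀ : Finset σ) => w' s)
    (fun s => u' s) (fun s => v' s) ?_
  rw [ht, ← hsum, ← Finset.sum_coe_sort]

/-- **KM Prop. 3 as printed (all cases of Def. 2), for families indexed by `Fin r`:** a reducible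
decomposition of `t` into `r` non-zero rank-one tensors yields a decomposition of `t` into `r − 1`
rank-one tensors. [cite: KauersMoosbauer2022FlipGraphs, Prop. 3] -/
theorem Reducible.exists_sum_triad_fin_pred {t : ι → κ → μ → K} {r : ℕ} {w : Fin r → ι → K}
    {u : Fin r → κ → K} {v : Fin r → μ → K} (hred : Reducible w u v)
    (h0 : ∀ s, triad (w s) (u s) (v s) ≠ 0) (ht : t = ∑ s, triad (w s) (u s) (v s)) :
    ∃ (w' : Fin (r - 1) → ι → K) (u' : Fin (r - 1) → κ → K) (v' : Fin (r - 1) → μ → K),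
      t = ∑ s, triad (w' s) (u' s) (v' s) := by
  obtain ⟨t₀, w', u', v', hsum⟩ := hred.exists_sum_erase_eq h0
  have hcard : Fintype.card (univ.erase t₀ : Finset (Fin r)) = r - 1 := by
    rw [Fintype.card_coe, Finset.card_erase_of_mem (Finset.mem_univ t₀), Finset.card_univ,
      Fintype.card_fin]
  let e : (univ.erase t₀ : Finset (Fin r)) ≃ Fin (r - 1) := Fintype.equivFinOfCardEq hcard
  refine ⟨fun i => w' (e.symm i), fun i => u' (e.symm i), fun i => v' (e.symm i), ?_⟩
  rw [ht, ← hsum, ← Finset.sum_coe_sort]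
  exact (e.symm.sum_comp (fun s : (univ.erase t₀ : Finset (Fin r)) =>
    triad (w' s) (u' s) (v' s))).symm

/-- **KM Prop. 3 verbatim for matrix multiplication schemes** ("Let `S` be a reducible
`(n,m,p)`-matrix multiplication scheme of rank `r`. Then there exists an `(n,m,p)`-matrix
multiplication scheme of rank `r − 1`"), in the tree's coordinates `matMulTensor K k m n = ⟨k,m,n⟩`,
for every one of the six cases of Def. 2; hence `R(⟨k,m,n⟩) ≤ r − 1`.
[cite: KauersMoosbauer2022FlipGraphs, Prop. 3] -/
theorem kauersMoosbauer2023_prop3' {k m n r : ℕ} {w : Fin r → Fin k × Fin n → K}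
    {u : Fin r → Fin k × Fin m → K} {v : Fin r → Fin m × Fin n → K}
    (hS : matMulTensor K k m n = ∑ s, triad (w s) (u s) (v s))
    (h0 : ∀ s, triad (w s) (u s) (v s) ≠ 0) (hred : Reducible w u v) :
    (∃ (w' : Fin (r - 1) → Fin k × Fin n → K) (u' : Fin (r - 1) → Fin k × Fin m → K)
        (v' : Fin (r - 1) → Fin m × Fin n → K),
        matMulTensor K k m n = ∑ s, triad (w' s) (u' s) (v' s)) ∧
      tensorRank (matMulTensor K k m n) ≤ r - 1 := by
  refine ⟨hred.exists_sum_triad_fin_pred h0 hS, ?_⟩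
  simpa using hred.tensorRank_le_card_sub_one h0 hS

end ReducibleDef

/-! ## §4 Def. 2 class by class (the reducibility test of flip-graph searches over `ℤ₂`) -/

section Classes

variable {K : Type*} [Field K] {ι κ μ : Type*} {σ : Type*}

/-- The image of a set on which a map is constant is a singleton (bookkeeping). [folklore] -/
private theorem image_eq_singleton_of_eqOn {V : Type*} {X : σ → V} {C : Set σ} {s₀ : σ}
    (hs₀ : s₀ ∈ C) (h : ∀ s ∈ C, X s = X s₀) : X '' C = {X s₀} := by
  ext y
  simp only [Set.mem_image, Set.mem_singleton_iff]
  constructor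
  · rintro ⟨s, hs, rfl⟩
    exact h s hs
  · rintro rfl
    exact ⟨s₀, hs₀, rfl⟩

variable [Fintype σ]

/-- The class `{s | X s = X s₀}` of a non-zero factor as Def. 2 data: a non-empty finite index set
on which `dim ⟨X s⟩ = 1` (bookkeeping, any field). [folklore] -/
private theorem exists_class_finset {V : Type*} [AddCommGroup V] [Module K V] (X : σ → V) (s₀ : σ)
    (hX : X s₀ ≠ 0) :
    ∃ I : Finset σ, I.Nonempty ∧ (I : Set σ) = {s | X s = X s₀} ∧
      finrank K (Submodule.span K (X '' (I : Set σ))) = 1 := by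
  refine ⟨(Set.toFinite {s | X s = X s₀}).toFinset, ?_, Set.Finite.coe_toFinset _, ?_⟩
  · exact ⟨s₀, (Set.Finite.mem_toFinset _).mpr rfl⟩
  · rw [Set.Finite.coe_toFinset,
      image_eq_singleton_of_eqOn (X := X) (C := {s | X s = X s₀}) (s₀ := s₀) rfl fun s hs => hs,
      finrank_span_singleton hX]

/-- **A sufficient condition for Def. 2, over any field:** if for some term `s₀` the terms whose
`X`-factor EQUALS `X^{(s₀)}` have linearly dependent `Y`-factors (for one of the six ordered pairs
`(X, Y)` of distinct slots), the family is reducible — take `I` = that class, on which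
`dim ⟨X^{(i)}⟩_{i∈I} = 1` trivially. This is the test implemented by flip-graph search codes.
[cite: KauersMoosbauer2022FlipGraphs, Def. 2] -/
theorem reducible_of_class_dep {w : σ → ι → K} {u : σ → κ → K} {v : σ → μ → K}
    (h0 : ∀ s, triad (w s) (u s) (v s) ≠ 0) (s₀ : σ)
    (h : (¬ LinearIndepOn K u {s | w s = w s₀} ∨ ¬ LinearIndepOn K v {s | w s = w s₀}) ∨
      (¬ LinearIndepOn K w {s | u s = u s₀} ∨ ¬ LinearIndepOn K v {s | u s = u s₀}) ∨
      (¬ LinearIndepOn K w {s | v s = v s₀} ∨ ¬ LinearIndepOn K u {s | v s = v s₀})) :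
    Reducible w u v := by
  obtain ⟨hw, hu, hv⟩ := ne_zero_of_triad_ne_zero (h0 s₀)
  rcases h with h | h | h
  · obtain ⟨I, hne, hIC, h1⟩ := exists_class_finset (K := K) w s₀ hw
    exact ⟨I, hne, Or.inl ⟨h1, by rw [hIC]; exact h⟩⟩
  · obtain ⟨I, hne, hIC, h1⟩ := exists_class_finset (K := K) u s₀ hu
    exact ⟨I, hne, Or.inr (Or.inl ⟨h1, by rw [hIC]; exact h⟩)⟩
  · obtain ⟨I, hne, hIC, h1⟩ := exists_class_finset (K := K) v s₀ hv
    exact ⟨I, hne, Or.inr (Or.inr ⟨h1, by rw [hIC]; exact h⟩)⟩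

/-- Over the field with two elements, non-zero vectors in a set spanning a line are equal
(bookkeeping). [folklore] -/
private theorem eq_of_finrank_span_eq_one_of_two (hK : ∀ x : K, x = 0 ∨ x = 1) {V : Type*}
    [AddCommGroup V] [Module K V] {S : Set V} (h1 : finrank K (Submodule.span K S) = 1) {x y : V}
    (hx : x ∈ S) (hy : y ∈ S) (hx0 : x ≠ 0) (hy0 : y ≠ 0) : x = y := by
  have hx' : (⟨x, Submodule.subset_span hx⟩ : Submodule.span K S) ≠ 0 := by
    intro h
    exact hx0 (by simpa using congrArg Subtype.val h)
  obtain ⟨c, hc⟩ := (finrank_eq_one_iff_of_nonzero' _ hx').mp h1 ⟨y, Submodule.subset_span hy⟩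
  have hc' : c • x = y := by simpa using congrArg Subtype.val hc
  rcases hK c with rfl | rfl
  · rw [zero_smul] at hc'
    exact absurd hc'.symm hy0
  · rwa [one_smul] at hc'

/-- **KM Def. 2 over `ℤ₂`, class by class.** Over the field with two elements, a family of non-zero
rank-one tensors is reducible (Def. 2, any of the six cases) iff for some term `s₀` and some ordered
pair `(X, Y)` of distinct slots, the `Y`-factors of the terms whose `X`-factor equals `X^{(s₀)}` are
linearly dependent: Def. 2 (1) over `ℤ₂` says exactly that all `X^{(i)}`, `i ∈ I`, equal the unique
non-zero vector of the line, so `I` lies in one such class, and dependence passes from `I` to the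
class. (A reformulation of Def. 2 for `K = ℤ₂`, the ground field of KM §4–5; the sufficiency half
`reducible_of_class_dep` holds over every field.)
[cite: KauersMoosbauer2022FlipGraphs, Def. 2 (with §3–4: ground field ℤ₂)] -/
theorem reducible_iff_exists_class_dep_of_two (hK : ∀ x : K, x = 0 ∨ x = 1) {w : σ → ι → K}
    {u : σ → κ → K} {v : σ → μ → K} (h0 : ∀ s, triad (w s) (u s) (v s) ≠ 0) :
    Reducible w u v ↔ ∃ s₀ : σ,
      (¬ LinearIndepOn K u {s | w s = w s₀} ∨ ¬ LinearIndepOn K v {s | w s = w s₀}) ∨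
      (¬ LinearIndepOn K w {s | u s = u s₀} ∨ ¬ LinearIndepOn K v {s | u s = u s₀}) ∨
      (¬ LinearIndepOn K w {s | v s = v s₀} ∨ ¬ LinearIndepOn K u {s | v s = v s₀}) := by
  refine ⟨fun hred => ?_, fun ⟨s₀, h⟩ => reducible_of_class_dep h0 s₀ h⟩
  have hw : ∀ s, w s ≠ 0 := fun s => (ne_zero_of_triad_ne_zero (h0 s)).1
  have hu : ∀ s, u s ≠ 0 := fun s => (ne_zero_of_triad_ne_zero (h0 s)).2.1
  have hv : ∀ s, v s ≠ 0 := fun s => (ne_zero_of_triad_ne_zero (h0 s)).2.2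
  obtain ⟨I, ⟨s₀, hs₀⟩, hI⟩ := hred
  refine ⟨s₀, ?_⟩
  -- in each case `I ⊆ {s | X s = X s₀}`, and dependence is inherited by supersets
  rcases hI with ⟨h1, h2⟩ | ⟨h1, h2⟩ | ⟨h1, h2⟩
  · have hsub : (I : Set σ) ⊆ {s | w s = w s₀} := fun s hs =>
      eq_of_finrank_span_eq_one_of_two hK h1 (Set.mem_image_of_mem w hs)
        (Set.mem_image_of_mem w (Finset.mem_coe.mpr hs₀)) (hw s) (hw s₀)
    exact Or.inl (h2.imp (fun h hC => h (hC.mono hsub)) fun h hC => h (hC.mono hsub))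
  · have hsub : (I : Set σ) ⊆ {s | u s = u s₀} := fun s hs =>
      eq_of_finrank_span_eq_one_of_two hK h1 (Set.mem_image_of_mem u hs)
        (Set.mem_image_of_mem u (Finset.mem_coe.mpr hs₀)) (hu s) (hu s₀)
    exact Or.inr (Or.inl (h2.imp (fun h hC => h (hC.mono hsub)) fun h hC => h (hC.mono hsub)))
  · have hsub : (I : Set σ) ⊆ {s | v s = v s₀} := fun s hs =>
      eq_of_finrank_span_eq_one_of_two hK h1 (Set.mem_image_of_mem v hs)
        (Set.mem_image_of_mem v (Finset.mem_coe.mpr hs₀)) (hv s) (hv s₀)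
    exact Or.inr (Or.inr (h2.imp (fun h hC => h (hC.mono hsub)) fun h hC => h (hC.mono hsub)))

end Classes

end FlipGraph

end Literature.Computability.AlgebraicComplexity
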